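import Summits.BirchSwinnertonDyer.BirchSwinnertonDyer.Theorems.ManinLocalTwoThreeThetaAnchorForms
import Summits.BirchSwinnertonDyer.BirchSwinnertonDyer.Theorems.ManinLocalTwoThreeSignCharacterKronecker
import HarnessLib

/-!
# The anchor forms exist (anchor discharge II of the E-an-152d port)

(route `ManinLocalTwoThree`, crux C2 `ManinOddAtFour` stmt-BirchSwinnertonDyer-22967; cell bsd-f2-manin, prover p3 gen 19.)

The Galois engine `…CDivisionGaloisEngine.false_of_conj_moves_class` of the E-an-152d port is stated under an
*anchor hypothesis*: every multiplicative sign character `χ` of `Γ₀(N)` that is trivial on `Γ₁(N)` and on the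
translations admits a holomorphic, cusp-bounded, nowhere-vanishing `g` with rational `q`-expansion transforming by
`χ` under some `Γ₀(N')`, `N ∣ N'`.  Here it is DISCHARGED: by part I (`exists_eq_jacobiSym_of_signCharacter`:
Diamond–Shurman §1.2 and Montgomery–Vaughan Thm. 9.13) `χ(γ) = (q₀/|d_γ|)` for odd `d_γ`, `q₀ ∣ N`; and the theta
anchor `g = ϑ₄(2τ)³ϑ₄(2q₀τ) = η(τ)⁶η(q₀τ)²/(η(2τ)³η(2q₀τ))` of `…ThetaAnchorForms.exists_thetaAnchor` (Newman's
eta-quotient theorem with Jacobi character) has exactly this character on `Γ₀(16q₀) ⊇ Γ₀(16N)`, where every `d_γ`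
is odd.  So `N' = 16N`, weight `2`.

BSD is not proved here; this is a helper toward the conditional closure `C2 ⟸ CDT ∧ E-an-152e`.
-/

open scoped MatrixGroups NumberTheorySymbols ModularForm Manifold
open CongruenceSubgroup UpperHalfPlane

namespace Summit.BirchSwinnertonDyer.BirchSwinnertonDyer.Theorems.ManinLocalTwoThree.EtaAnchor

/-- `Γ₀(M') ≤ Γ₀(M)` for `M ∣ M'`. [cite: DiamondShurman2005, §1.2] -/
private theorem mem_gamma0_of_dvd {M M' : ℕ} (h : M ∣ M') {γ : SL(2, ℤ)} (hγ : γ ∈ Gamma0 M') : γ ∈ Gamma0 M := by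
  rw [Gamma0_mem, ZMod.intCast_zmod_eq_zero_iff_dvd] at hγ ⊢
  exact (Int.natCast_dvd_natCast.mpr h).trans hγ

/-- `d_γ` is odd for `γ ∈ Γ₀(M)`, `M` even (`ad − bc = 1` with `c` even). [folklore] -/
private theorem odd_apply_one_one_of_mem_gamma0 {M : ℕ} (hM : Even M) {γ : SL(2, ℤ)} (hγ : γ ∈ Gamma0 M) :
    Odd (γ 1 1) := by
  have hc : ((M : ℕ) : ℤ) ∣ γ 1 0 := by
    rw [Gamma0_mem] at hγ
    exact (ZMod.intCast_zmod_eq_zero_iff_dvd _ _).mp hγ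
  have hce : Even (γ 1 0) :=
    even_iff_two_dvd.mpr ((Int.natCast_dvd_natCast.mpr (even_iff_two_dvd.mp hM)).trans hc)
  by_contra h
  rw [Int.not_odd_iff_even] at h
  have hdet := Matrix.SpecialLinearGroup.det_coe γ
  rw [Matrix.det_fin_two] at hdet
  have h2 : Even ((γ : Matrix (Fin 2) (Fin 2) ℤ) 0 0 * γ 1 1 - γ 0 1 * γ 1 0) := (h.mul_left _).sub (hce.mul_left _)
  rw [hdet] at h2
  exact Int.not_even_one h2

/-- **The anchor hypothesis of the E-an-152d Galois engine holds.**  For every `N ≥ 1` and every `χ : SL(2, ℤ) → ℤ`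
which on `Γ₀(N)` takes the values `±1`, is multiplicative, is `1` when `d_γ ≡ 1 (mod N)` and is `1` when `c_γ = 0`,
there are `N' = 16N`, the weight `k_g = 2`, a holomorphic `g : ℍ → ℂ` bounded at every cusp and nowhere zero, with
rational `q`-expansion `g = Σ cₙ qⁿ`, and `g ∣₂ γ = χ(γ) g` for all `γ ∈ Γ₀(N')` — namely `g = ϑ₄(2τ)³ ϑ₄(2q₀τ)` with
`q₀ ∣ N` the conductor of the Dirichlet character underlying `χ`.
[cite: DiamondShurman2005, §1.2] [cite: MontgomeryVaughan2007, Theorem 9.13] [cite: Newman1959] -/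
theorem anchor_exists (N : ℕ) [NeZero N] (χ : SL(2, ℤ) → ℤ)
    (h1 : ∀ γ ∈ Gamma0 N, χ γ = 1 ∨ χ γ = -1)
    (h2 : ∀ γ ∈ Gamma0 N, ∀ δ ∈ Gamma0 N, χ (γ * δ) = χ γ * χ δ)
    (h3 : ∀ γ ∈ Gamma0 N, ((γ 1 1 : ℤ) : ZMod N) = 1 → χ γ = 1)
    (h4 : ∀ γ ∈ Gamma0 N, γ 1 0 = 0 → χ γ = 1) :
    ∃ (N' : ℕ) (kg : ℤ) (g : ℍ → ℂ) (cg : ℕ → ℚ), N ∣ N' ∧ 0 < N' ∧ MDifferentiable 𝓘(ℂ) 𝓘(ℂ) g ∧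
      (∀ δ : SL(2, ℤ), IsBoundedAtImInfty (g ∣[kg] δ)) ∧
      (∀ γ ∈ Gamma0 N', g ∣[kg] γ = ((χ γ : ℤ) : ℂ) • g) ∧
      (∀ τ : ℍ, HasSum (fun n : ℕ ↦ ((cg n : ℚ) : ℂ) * Function.Periodic.qParam 1 (τ : ℂ) ^ n) (g τ)) ∧
      (∀ τ : ℍ, g τ ≠ 0) := by
  obtain ⟨q₀, hq₀, hq₀N, hχ⟩ := exists_eq_jacobiSym_of_signCharacter χ h1 h2 h3 h4
  obtain ⟨g, c, hhol, hbd, hslash, hsum, hne⟩ := exists_thetaAnchor q₀ hq₀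
  refine ⟨16 * N, 2, g, c, Dvd.intro_left 16 rfl, Nat.mul_pos (by norm_num) (Nat.pos_of_ne_zero (NeZero.ne N)),
    hhol, hbd, fun γ hγ ↦ ?_, hsum, hne⟩
  have hγq : γ ∈ Gamma0 (16 * q₀) := mem_gamma0_of_dvd (Nat.mul_dvd_mul_left 16 hq₀N) hγ
  have hγN : γ ∈ Gamma0 N := mem_gamma0_of_dvd (Dvd.intro_left 16 rfl) hγ
  have hodd : Odd (γ 1 1) := odd_apply_one_one_of_mem_gamma0 ⟨8 * N, by ring⟩ hγ
  rw [hslash γ hγq, hχ γ hγN hodd]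

end Summit.BirchSwinnertonDyer.BirchSwinnertonDyer.Theorems.ManinLocalTwoThree.EtaAnchor
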